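import Mathlib.Analysis.SpecialFunctions.ImproperIntegrals
import Mathlib.Analysis.SpecialFunctions.Integrals.Basic
import Mathlib.MeasureTheory.Integral.IntegralEqImproper

/-!
# `SignCone.ConeMagnification`, line `Sketch` (r4): the Cauchy–Poisson semigroup integral
(crux stmt-RiemannHypothesis-16303; HELPER file, `--supports`)

Skeleton r4 of the line states the Carathéodory majorant of the open core `stub_torusOfCara` with the POISSON
EXTENSION `𝒜(s) = (1/2π) ∫ Re ψ(1/4 + iv/2) · (σ − 1/2)/((σ − 1/2)² + (t − v)²) dv` of the archimedean density,
where r3 (and the landed special cases `torusOfCara_of_eventually_vonMangoldt`, `torusOfCara_of_summable` and the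
calibration `exists_large_re_riemannZeta0_of_stub_torusOfCara`) had `½ Re ψ(s/2)`.  The two agree
(`…PoissonDigamma.lean`: `𝒜(s) = ½ Re ψ(s/2)` on `Re s > 1/2`); the calculus input, proved here, is the
semigroup law of the Cauchy/Poisson kernels on the line:

  `∫_ℝ a/(a² + v²) · b/(b² + (t − v)²) dv = π (a + b)/((a + b)² + t²)`   (`a, b > 0`, `t ∈ ℝ`)

(`integral_cauchy_mul_poisson`), by an explicit primitive (partial fractions:
`Δ · ab/((a²+v²)(b²+(v−t)²)) = d/dv [abt (log(a²+v²) − log(b²+(v−t)²)) + b(b²+t²−a²) arctan(v/a) + a(a²+t²−b²) arctan((v−t)/b)]`,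
`Δ = ((a−b)²+t²)((a+b)²+t²)`, limits `±π/2` of the arctangents; the doubly degenerate case `a = b, t = 0` has the
primitive `(arctan(v/a) + av/(a²+v²))/(2a)`), as in the tree's `Literature/NumberTheory/LFunctions/MontgomeryCauchyKernel.lean`
(equal scales).  Also: `∫ x₀/(x₀² + (t−v)²) dv = π` (`integral_poisson`) and integrability lemmas.
-/

noncomputable section

-- `Summit.RiemannHypothesis.RiemannHypothesis.…` repeats a namespace component by design (D-0017 layout).
set_option linter.dupNamespace false

open Real Filter MeasureTheory Set
open scoped Topology

namespace Summit.RiemannHypothesis.RiemannHypothesis.Theorems.SignConeConeMagnification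

/-! ## The Poisson kernel on the line -/

/-- **Mass of the Poisson kernel**: `∫ x₀/(x₀² + (t − v)²) dv = π` for `x₀ > 0`. [folklore] -/
theorem integral_poisson {x₀ : ℝ} (hx₀ : 0 < x₀) (t : ℝ) :
    ∫ v : ℝ, x₀ / (x₀ ^ 2 + (t - v) ^ 2) = π := by
  have h1 : (fun v : ℝ => x₀ / (x₀ ^ 2 + (t - v) ^ 2)) =
      fun v => (fun u : ℝ => x₀⁻¹ * (1 + u ^ 2)⁻¹) (x₀⁻¹ * (v - t)) := by
    funext v
    have hx : x₀ ≠ 0 := hx₀.ne'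
    field_simp
    ring
  rw [h1, integral_sub_right_eq_self (fun v => (fun u : ℝ => x₀⁻¹ * (1 + u ^ 2)⁻¹) (x₀⁻¹ * v)) t,
    Measure.integral_comp_mul_left (fun u : ℝ => x₀⁻¹ * (1 + u ^ 2)⁻¹) x₀⁻¹, inv_inv, abs_of_pos hx₀,
    integral_const_mul, integral_univ_inv_one_add_sq, smul_eq_mul]
  field_simp

/-- Integrability of the Poisson kernel. [folklore] -/
theorem integrable_poisson {x₀ : ℝ} (hx₀ : 0 < x₀) (t : ℝ) :
    Integrable fun v : ℝ => x₀ / (x₀ ^ 2 + (t - v) ^ 2) :=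
  Integrable.of_integral_ne_zero (by rw [integral_poisson hx₀ t]; exact Real.pi_pos.ne')

/-- Integrability of the centred Cauchy kernel `a/(a² + v²)`. [folklore] -/
theorem integrable_cauchy {a : ℝ} (ha : 0 < a) : Integrable fun v : ℝ => a / (a ^ 2 + v ^ 2) := by
  have h := integrable_poisson ha 0
  refine h.congr (Eventually.of_forall fun v => ?_)
  simp

/-- Integrability of the product of a Cauchy kernel and a Poisson kernel. [folklore] -/
theorem integrable_cauchy_mul_poisson {a b : ℝ} (ha : 0 < a) (hb : 0 < b) (t : ℝ) :
    Integrable fun v : ℝ => a / (a ^ 2 + v ^ 2) * (b / (b ^ 2 + (t - v) ^ 2)) := by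
  refine ((integrable_poisson hb t).const_mul a⁻¹).mono' ?_ (Eventually.of_forall fun v => ?_)
  · refine Continuous.aestronglyMeasurable (Continuous.mul ?_ ?_)
    · exact continuous_const.div (by fun_prop) fun v => by positivity
    · exact continuous_const.div (by fun_prop) fun v => by positivity
  · rw [Real.norm_of_nonneg (by positivity)]
    have h1 : a / (a ^ 2 + v ^ 2) ≤ a⁻¹ := by
      rw [div_le_iff₀ (by positivity), inv_mul_eq_div, le_div_iff₀ ha]
      nlinarith [sq_nonneg v]
    exact mul_le_mul_of_nonneg_right h1 (by positivity)

/-! ## Limits at `±∞` -/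

/-- `(a² + v²)/(b² + (v − t)²) → 1` as `v → ±∞` (any filter along which `v⁻¹ → 0`, eventually `v ≠ 0`). [folklore] -/
theorem tendsto_sq_add_sq_div (a : ℝ) {b : ℝ} (hb : 0 < b) (t : ℝ) {l : Filter ℝ}
    (hl : Tendsto (fun v : ℝ => v⁻¹) l (𝓝 0)) (hl' : ∀ᶠ v in l, v ≠ 0) :
    Tendsto (fun v : ℝ => (a ^ 2 + v ^ 2) / (b ^ 2 + (v - t) ^ 2)) l (𝓝 1) := by
  have hφ : ContinuousAt (fun s : ℝ => (a ^ 2 * s ^ 2 + 1) / (b ^ 2 * s ^ 2 + (1 - t * s) ^ 2)) 0 :=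
    ContinuousAt.div (by fun_prop) (by fun_prop) (by norm_num)
  have h1 : Tendsto (fun s : ℝ => (a ^ 2 * s ^ 2 + 1) / (b ^ 2 * s ^ 2 + (1 - t * s) ^ 2)) (𝓝 0) (𝓝 1) := by
    simpa using hφ.tendsto
  refine (h1.comp hl).congr' ?_
  filter_upwards [hl'] with v hv
  simp only [Function.comp]
  have hden : b ^ 2 + (v - t) ^ 2 ≠ 0 := by positivity
  rw [div_eq_div_iff ?_ hden]
  · field_simp
  · have : 0 < b ^ 2 * v⁻¹ ^ 2 := by positivity
    positivity

/-- `log(a² + v²) − log(b² + (v − t)²) → 0` as `v → ±∞`. [folklore] -/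
theorem tendsto_log_sq_add_sq_sub {a b : ℝ} (ha : 0 < a) (hb : 0 < b) (t : ℝ) {l : Filter ℝ}
    (hl : Tendsto (fun v : ℝ => v⁻¹) l (𝓝 0)) (hl' : ∀ᶠ v in l, v ≠ 0) :
    Tendsto (fun v : ℝ => Real.log (a ^ 2 + v ^ 2) - Real.log (b ^ 2 + (v - t) ^ 2)) l (𝓝 0) := by
  have h := ((Real.continuousAt_log one_ne_zero).tendsto.comp (tendsto_sq_add_sq_div a hb t hl hl'))
  rw [Real.log_one] at h
  refine h.congr fun v => ?_
  simp only [Function.comp]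
  rw [Real.log_div (by positivity) (by positivity)]

/-- `a v/(a² + v²) → 0` as `v → ±∞`. [folklore] -/
theorem tendsto_mul_div_sq_add_sq (a : ℝ) {l : Filter ℝ} (hl : Tendsto (fun v : ℝ => v⁻¹) l (𝓝 0))
    (hl' : ∀ᶠ v in l, v ≠ 0) :
    Tendsto (fun v : ℝ => a * v / (a ^ 2 + v ^ 2)) l (𝓝 0) := by
  have hφ : ContinuousAt (fun s : ℝ => a * s / (a ^ 2 * s ^ 2 + 1)) 0 :=
    ContinuousAt.div (by fun_prop) (by fun_prop) (by norm_num)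
  have h1 : Tendsto (fun s : ℝ => a * s / (a ^ 2 * s ^ 2 + 1)) (𝓝 0) (𝓝 0) := by
    simpa using hφ.tendsto
  refine (h1.comp hl).congr' ?_
  filter_upwards [hl'] with v hv
  simp only [Function.comp]
  rcases eq_or_ne a 0 with rfl | ha
  · simp
  · have hden : a ^ 2 + v ^ 2 ≠ 0 := by positivity
    rw [div_eq_div_iff ?_ hden]
    · field_simp
    · have : 0 < a ^ 2 * v⁻¹ ^ 2 := by positivity
      positivity

/-! ## The primitives -/

/-- The primitive in the non-degenerate case (valid identically; it degenerates to `0 = 0` when `a = b`, `t = 0`):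
`d/dv [abt (log(a²+v²) − log(b²+(v−t)²)) + b(b²+t²−a²) arctan(v/a) + a(a²+t²−b²) arctan((v−t)/b)]
 = ((a−b)²+t²)((a+b)²+t²) · a/(a²+v²) · b/(b²+(t−v)²)`. [folklore] -/
theorem hasDerivAt_cauchyPoissonPrimitive {a b : ℝ} (ha : 0 < a) (hb : 0 < b) (t v : ℝ) :
    HasDerivAt (fun v : ℝ => a * b * t * (Real.log (a ^ 2 + v ^ 2) - Real.log (b ^ 2 + (v - t) ^ 2)) +
        b * (b ^ 2 + t ^ 2 - a ^ 2) * Real.arctan (v / a) +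
        a * (a ^ 2 + t ^ 2 - b ^ 2) * Real.arctan ((v - t) / b))
      (((a - b) ^ 2 + t ^ 2) * ((a + b) ^ 2 + t ^ 2) * (a / (a ^ 2 + v ^ 2) * (b / (b ^ 2 + (t - v) ^ 2)))) v := by
  have h1 : a ^ 2 + v ^ 2 ≠ 0 := by positivity
  have h2 : b ^ 2 + (v - t) ^ 2 ≠ 0 := by positivity
  have h2' : b ^ 2 + (t - v) ^ 2 ≠ 0 := by positivity
  have h3 : 1 + (v / a) ^ 2 ≠ 0 := by positivity
  have h4 : 1 + ((v - t) / b) ^ 2 ≠ 0 := by positivity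
  have ha' : a ≠ 0 := ha.ne'
  have hb' : b ≠ 0 := hb.ne'
  have dA : HasDerivAt (fun v : ℝ => Real.log (a ^ 2 + v ^ 2)) (2 * v / (a ^ 2 + v ^ 2)) v := by
    have : HasDerivAt (fun v : ℝ => a ^ 2 + v ^ 2) (2 * v) v := by
      simpa using (hasDerivAt_pow 2 v).const_add (a ^ 2)
    exact this.log h1
  have dB : HasDerivAt (fun v : ℝ => Real.log (b ^ 2 + (v - t) ^ 2)) (2 * (v - t) / (b ^ 2 + (v - t) ^ 2)) v := by
    have : HasDerivAt (fun v : ℝ => b ^ 2 + (v - t) ^ 2) (2 * (v - t)) v := by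
      simpa using ((hasDerivAt_id v).sub_const t).pow 2 |>.const_add (b ^ 2)
    exact this.log h2
  have dC : HasDerivAt (fun v : ℝ => Real.arctan (v / a)) (1 / (1 + (v / a) ^ 2) * (1 / a)) v :=
    ((hasDerivAt_id' v).div_const a).arctan
  have dD : HasDerivAt (fun v : ℝ => Real.arctan ((v - t) / b)) (1 / (1 + ((v - t) / b) ^ 2) * (1 / b)) v :=
    (((hasDerivAt_id' v).sub_const t).div_const b).arctan
  have key := (((dA.sub dB).const_mul (a * b * t)).add (dC.const_mul (b * (b ^ 2 + t ^ 2 - a ^ 2)))).add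
    (dD.const_mul (a * (a ^ 2 + t ^ 2 - b ^ 2)))
  refine key.congr_deriv ?_
  field_simp
  ring

/-- The primitive in the doubly degenerate case `a = b`, `t = 0`:
`d/dv [(arctan(v/a) + av/(a²+v²))/(2a)] = a/(a²+v²) · a/(a²+(0−v)²)`. [folklore] -/
theorem hasDerivAt_cauchyPoissonPrimitive_deg {a : ℝ} (ha : 0 < a) (v : ℝ) :
    HasDerivAt (fun v : ℝ => (Real.arctan (v / a) + a * v / (a ^ 2 + v ^ 2)) / (2 * a))
      (a / (a ^ 2 + v ^ 2) * (a / (a ^ 2 + (0 - v) ^ 2))) v := by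
  have h1 : a ^ 2 + v ^ 2 ≠ 0 := by positivity
  have h3 : 1 + (v / a) ^ 2 ≠ 0 := by positivity
  have ha' : a ≠ 0 := ha.ne'
  have dC : HasDerivAt (fun v : ℝ => Real.arctan (v / a)) (1 / (1 + (v / a) ^ 2) * (1 / a)) v :=
    ((hasDerivAt_id' v).div_const a).arctan
  have dN : HasDerivAt (fun v : ℝ => a ^ 2 + v ^ 2) (2 * v) v := by
    simpa using (hasDerivAt_pow 2 v).const_add (a ^ 2)
  have dQ := ((hasDerivAt_id' v).const_mul a).div dN h1
  have key := (dC.add dQ).div_const (2 * a)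
  refine key.congr_deriv ?_
  field_simp
  ring

/-! ## The semigroup integral -/

/-- **Cauchy–Poisson semigroup law on the line**: for `a, b > 0` and real `t`,
`∫_ℝ a/(a² + v²) · b/(b² + (t − v)²) dv = π (a + b)/((a + b)² + t²)`
(the Poisson integral at height `b` of the Cauchy density of scale `a` is the Cauchy density of scale `a + b`). [folklore] -/
theorem integral_cauchy_mul_poisson {a b : ℝ} (ha : 0 < a) (hb : 0 < b) (t : ℝ) :
    ∫ v : ℝ, a / (a ^ 2 + v ^ 2) * (b / (b ^ 2 + (t - v) ^ 2)) = π * (a + b) / ((a + b) ^ 2 + t ^ 2) := by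
  have htop : Tendsto (fun v : ℝ => v⁻¹) atTop (𝓝 0) := tendsto_inv_atTop_zero
  have hbot : Tendsto (fun v : ℝ => v⁻¹) atBot (𝓝 0) := tendsto_inv_atBot_zero
  have htop' : ∀ᶠ v : ℝ in atTop, v ≠ 0 := (eventually_gt_atTop 0).mono fun v hv => hv.ne'
  have hbot' : ∀ᶠ v : ℝ in atBot, v ≠ 0 := (eventually_lt_atBot 0).mono fun v hv => hv.ne
  have hat : Tendsto Real.arctan atTop (𝓝 (π / 2)) :=
    tendsto_nhds_of_tendsto_nhdsWithin Real.tendsto_arctan_atTop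
  have hab : Tendsto Real.arctan atBot (𝓝 (-(π / 2))) :=
    tendsto_nhds_of_tendsto_nhdsWithin Real.tendsto_arctan_atBot
  have hat1 : Tendsto (fun v : ℝ => Real.arctan (v / a)) atTop (𝓝 (π / 2)) :=
    hat.comp (tendsto_id.atTop_div_const ha)
  have hab1 : Tendsto (fun v : ℝ => Real.arctan (v / a)) atBot (𝓝 (-(π / 2))) :=
    hab.comp (tendsto_id.atBot_div_const ha)
  have hsubT : Tendsto (fun v : ℝ => v - t) atTop atTop :=
    (tendsto_atTop_add_const_right atTop (-t) tendsto_id).congr fun v => by simp [sub_eq_add_neg]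
  have hsubB : Tendsto (fun v : ℝ => v - t) atBot atBot :=
    (tendsto_atBot_add_const_right atBot (-t) tendsto_id).congr fun v => by simp [sub_eq_add_neg]
  have hat2 : Tendsto (fun v : ℝ => Real.arctan ((v - t) / b)) atTop (𝓝 (π / 2)) :=
    hat.comp (hsubT.atTop_div_const hb)
  have hab2 : Tendsto (fun v : ℝ => Real.arctan ((v - t) / b)) atBot (𝓝 (-(π / 2))) :=
    hab.comp (hsubB.atBot_div_const hb)
  by_cases hdeg : a = b ∧ t = 0
  · -- doubly degenerate case: `∫ a²/(a²+v²)² = π/(2a)`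
    obtain ⟨rfl, rfl⟩ := hdeg
    have h := integral_of_hasDerivAt_of_tendsto (m := (-(π / 2) + 0) / (2 * a)) (n := (π / 2 + 0) / (2 * a))
      (hasDerivAt_cauchyPoissonPrimitive_deg ha) (integrable_cauchy_mul_poisson ha ha 0) ?_ ?_
    · rw [h]
      have ha' : a ≠ 0 := ha.ne'
      field_simp
      ring
    · exact (hab1.add (tendsto_mul_div_sq_add_sq a hbot hbot')).div_const _
    · exact (hat1.add (tendsto_mul_div_sq_add_sq a htop htop')).div_const _
  · -- non-degenerate case: `Δ ≠ 0`
    have hD1 : 0 < (a - b) ^ 2 + t ^ 2 := by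
      rcases not_and_or.mp hdeg with h | h
      · have : a - b ≠ 0 := sub_ne_zero.mpr h
        positivity
      · positivity
    have hD2 : 0 < (a + b) ^ 2 + t ^ 2 := by positivity
    set Δ : ℝ := ((a - b) ^ 2 + t ^ 2) * ((a + b) ^ 2 + t ^ 2) with hΔ
    have hΔ0 : Δ ≠ 0 := by positivity
    have h := integral_of_hasDerivAt_of_tendsto
      (m := a * b * t * 0 + b * (b ^ 2 + t ^ 2 - a ^ 2) * (-(π / 2)) + a * (a ^ 2 + t ^ 2 - b ^ 2) * (-(π / 2)))
      (n := a * b * t * 0 + b * (b ^ 2 + t ^ 2 - a ^ 2) * (π / 2) + a * (a ^ 2 + t ^ 2 - b ^ 2) * (π / 2))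
      (hasDerivAt_cauchyPoissonPrimitive ha hb t) ((integrable_cauchy_mul_poisson ha hb t).const_mul Δ) ?_ ?_
    · rw [integral_const_mul] at h
      have hI : ∫ v : ℝ, a / (a ^ 2 + v ^ 2) * (b / (b ^ 2 + (t - v) ^ 2)) =
          (a * b * t * 0 + b * (b ^ 2 + t ^ 2 - a ^ 2) * (π / 2) + a * (a ^ 2 + t ^ 2 - b ^ 2) * (π / 2) -
            (a * b * t * 0 + b * (b ^ 2 + t ^ 2 - a ^ 2) * (-(π / 2)) +
              a * (a ^ 2 + t ^ 2 - b ^ 2) * (-(π / 2)))) / Δ := by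
        rw [eq_div_iff hΔ0, mul_comm]
        exact h
      rw [hI, hΔ, div_eq_div_iff hΔ0 hD2.ne']
      ring
    · exact (((tendsto_log_sq_add_sq_sub ha hb t hbot hbot').const_mul _).add (hab1.const_mul _)).add
        (hab2.const_mul _)
    · exact (((tendsto_log_sq_add_sq_sub ha hb t htop htop').const_mul _).add (hat1.const_mul _)).add
        (hat2.const_mul _)

/-- **Registered sub-goal form** (closed statement) of `integral_cauchy_mul_poisson`: the Cauchy–Poisson semigroup law
`∫_ℝ a/(a² + v²) · b/(b² + (t − v)²) dv = π (a + b)/((a + b)² + t²)` for all `a, b > 0`, `t ∈ ℝ`. [folklore] -/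
theorem cauchyPoissonSemigroup :
    ∀ a b t : ℝ, 0 < a → 0 < b →
      ∫ v : ℝ, a / (a ^ 2 + v ^ 2) * (b / (b ^ 2 + (t - v) ^ 2)) = Real.pi * (a + b) / ((a + b) ^ 2 + t ^ 2) :=
  fun _ _ t ha hb => integral_cauchy_mul_poisson ha hb t

end Summit.RiemannHypothesis.RiemannHypothesis.Theorems.SignConeConeMagnification

end
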